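import Literature.NumberTheory.EllipticCurves.Rank1Residual.Typed.SelmerCardCertificate
import Literature.NumberTheory.EllipticCurves.Rank1Residual.Typed.CasselsLowerBound
import Literature.NumberTheory.EllipticCurves.HeegnerPointsKolyvaginDescentProofs
import Literature.NumberTheory.EllipticCurves.MordellWeilTheoremProofs
import Literature.NumberTheory.EllipticCurves.SelmerGroupCardinality
import HarnessLib

/-!
# The `p`-descent certificate in its native shape, rank `0`: `Sel^(p)(E/K) ≠ 0` at rank `0` without rational `p`-torsion gives `Ш(E/K)[p] ≠ 0` (cell `b2b-bsdres`)

HONEST FRAMING (run/shared/lean/b2b/bsd-rank1-residual/, verbatim): the goal of the cell is to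
DELETE the COMBINATION-SHAPED residual classes for ALL analytic-rank `≤ 1` elliptic curves over `ℚ`
— "full BSD formula for every rank `≤ 1` curve in class C" assembled STRICTLY from published
theorems — so that the rank-`≤ 1` remainder becomes exactly the CONSTRUCTION-SHAPED classes, which
are TYPED (missing-input `Prop`s), NOT attempted. This is not "finishing BSD".

Theorems only (no definition, no named fact). Rank-`0` companion of `SelmerCardCertificate.lean`
(rank `≤ 1`, `p ∤ #Ш_an`: `#Sel^(p) = p` + a point outside `pE` ⇒ `Ш[p] = 0`) feeding
`Typed/CasselsLowerBound.lean` (x11b gen 3: Wuthrich's upper bound + Cassels–Tate squareness + the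
certificate `p ∣ #Ш(E/ℚ)` ⇒ `BSD(E,p)` at a rank-`0` pair with `ord_p #Ш_an ≤ 2`).

**What this file records.** For the cell's rank-`0` pairs with `#Ш_an = 9` (X11 ∧ `p = 3`: 14 pairs
of census v5; also X6/X7/X8 pairs, `HOME/b2b-bsdres-x11b/desc3/CERTIFICATES.md`) the EXACT `3`-descent
outputs `dim_𝔽₃ Sel^(3)(E/ℚ) = 2`, in particular `Sel^(3)(E/ℚ) ≠ 0`; the passage to "`Ш(E/ℚ)[3] ≠ 0`,
hence `3 ∣ #Ш(E/ℚ)`" used `E(ℚ)/3E(ℚ) = 0` (rank `0` by Gross–Zagier–Kolyvagin, no rational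
`3`-torsion) — step (T5) of `CERTIFICATES.md` §2, a paper step. Here it is a kernel theorem:

* `exists_sha_torsion_of_selmerGroup_ne_bot` (any number field): if `Sel^(p)(E/K) ≠ 0`,
  `rank_ℤ E(K) = 0` and `p ∤ #E(K)_tors`, then `Ш(E/K)` has a non-zero element killed by `p`.
  Proof: Mordell–Weil (`module_finite_point_holds`, PROVED in the tree) makes `E(K)` finite of order
  prime to `p`... precisely: no `p`-torsion + rank `0` give `pE(K) = E(K)`
  (`range_zsmul_eq_top_of_finrank_eq_zero`), so the Kummer map of the PROVED fundamental exact
  sequence (`selmer_exact_holds`) is zero, `Sel^(p) ∩ ker(H¹(K,E[p]) → H¹(K,E)) = 0`, and a non-zero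
  Selmer class maps to a non-zero class of `Ш(E/K)[p]`.
* `X11ThreeRankZero.bsdp_of_casselsTate_of_selmerThree_ne_bot`: `BSD(E,3)` at a rank-`0` X11 pair
  with `surj(3)` and `ord_3 #Ш_an ≤ 2` from PUBLISHED theorems (binders of
  `X11ThreeRankZero.bsdp_of_casselsTate_of_three_dvd`: Cassels–Tate `hCT`, Wuthrich Prop. 21 `hW`,
  GZK `hGZK`, modularity `hmod`) plus the native certificate line `Sel^(3)(E/ℚ) ≠ 0`; the side
  conditions `rank = 0` and `3 ∤ #E(ℚ)_tors` are DERIVED (GZK at `r_an = 0`; `irr(3)` from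
  `ClassX11`, Mazur: `padicValNat_torsionOrder_eq_zero_of_irreducible`). Not a class theorem.
* `bsdp_of_wuthrich_of_casselsTate_of_selmerGroup_ne_bot` (appended): the class-free form (rank `0`,
  `p` odd, not additive at `p`, surjective-or-Borel image, `ord_p #Ш_an ≤ 2`, `p ∤ #E(ℚ)_tors`,
  `Sel^(p)(E/ℚ) ≠ 0` ⇒ `BSD(E,p)`), for the rank-`0` `#Ш_an = 9` pairs of any class.
-/

noncomputable section

open scoped Classical

open WeierstrassCurve Literature.NumberTheory.EllipticCurves

namespace Literature.NumberTheory.EllipticCurves.Rank1Residual.Typed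

section General

variable {K : Type*} [Field K] [NumberField K] (W : WeierstrassCurve K) [W.IsElliptic]

/-- **Rank-`0` native `p`-descent certificate: `Sel^(p)(E/K) ≠ 0`, `rank_ℤ E(K) = 0`,
`p ∤ #E(K)_tors` ⇒ `Ш(E/K)[p] ≠ 0`** (a non-zero element of `Ш(E/K)` killed by `p`). Mordell–Weil
(tree theorem `module_finite_point_holds`) and the two side conditions give `pE(K) = E(K)`, so in the
PROVED fundamental exact sequence `0 → E(K)/pE(K) → Sel^(p) → Ш[p] → 0` (`selmer_exact_holds`) the
first term vanishes and `Sel^(p) ≅ Ш(E/K)[p]`. [cite: SilvermanAEC2009, Thm X.4.2(a)] -/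
theorem exists_sha_torsion_of_selmerGroup_ne_bot (p : ℕ) [hp : Fact p.Prime]
    (hSel : W.selmerGroup (p : ℤ) ≠ ⊥) (hrank : W.mordellWeilRank = 0)
    (htors : ¬ p ∣ W.torsionOrder) :
    ∃ x : W.sha, x ≠ 0 ∧ p • x = 0 := by
  have hp0 : (p : ℤ) ≠ 0 := by exact_mod_cast hp.out.ne_zero
  obtain ⟨κ, hker, hrange, hmap⟩ := selmer_exact_holds W (p : ℤ) hp0
  haveI : Module.Finite ℤ W.toAffine.Point := W.module_finite_point_holds
  -- no rational `p`-torsion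
  have htorsBy : AddSubgroup.torsionBy W.toAffine.Point (p : ℤ) = ⊥ := by
    rw [eq_bot_iff]
    intro P hP
    rw [AddSubgroup.mem_bot]
    by_contra hP0
    have hpP : p • P = 0 := AddSubgroup.torsionBy.nsmul_iff.mp hP
    have hord : addOrderOf P = p := addOrderOf_eq_prime hpP hP0
    have hfin : IsOfFinAddOrder P := by
      rw [← addOrderOf_pos_iff, hord]; exact hp.out.pos
    have hmemT : P ∈ AddCommGroup.torsion W.toAffine.Point := by
      rw [AddCommGroup.mem_torsion]; exact hfin
    have hordT : addOrderOf (⟨P, hmemT⟩ : AddCommGroup.torsion W.toAffine.Point) = p := by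
      rw [← AddSubgroup.addOrderOf_coe]; exact hord
    apply htors
    have := addOrderOf_dvd_natCard (⟨P, hmemT⟩ : AddCommGroup.torsion W.toAffine.Point)
    rw [hordT] at this
    exact this
  have hfinrank : Module.finrank ℤ W.toAffine.Point = 0 := hrank
  have htop := range_zsmul_eq_top_of_finrank_eq_zero (A := W.toAffine.Point) htorsBy hfinrank
  -- the Kummer map vanishes
  have hκ0 : κ.range = ⊥ := by
    rw [eq_bot_iff]
    rintro _ ⟨P, rfl⟩
    rw [AddSubgroup.mem_bot, ← AddMonoidHom.mem_ker, hker, htop]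
    exact AddSubgroup.mem_top P
  have hinf : W.selmerGroup (p : ℤ) ⊓ (W.torsionH1ToH1 (p : ℤ)).ker = ⊥ := by
    rw [← hrange, hκ0]
  -- a non-zero Selmer class and its image in `Ш`
  obtain ⟨c, hcSel, hc0⟩ := (W.selmerGroup (p : ℤ)).bot_or_exists_ne_zero.resolve_left hSel
  have hTc : W.torsionH1ToH1 (p : ℤ) c ≠ 0 := by
    intro h0
    have : c ∈ W.selmerGroup (p : ℤ) ⊓ (W.torsionH1ToH1 (p : ℤ)).ker :=
      ⟨hcSel, (AddMonoidHom.mem_ker).mpr h0⟩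
    rw [hinf, AddSubgroup.mem_bot] at this
    exact hc0 this
  have hmem : W.torsionH1ToH1 (p : ℤ) c ∈ W.sha ⊓ AddSubgroup.torsionBy W.galH1 (p : ℤ) := by
    rw [← hmap]
    exact ⟨c, hcSel, rfl⟩
  refine ⟨⟨W.torsionH1ToH1 (p : ℤ) c, hmem.1⟩, ?_, ?_⟩
  · intro h
    exact hTc (congrArg Subtype.val h)
  · apply Subtype.ext
    simpa only [AddSubgroupClass.coe_nsmul, ZeroMemClass.coe_zero] using
      AddSubgroup.torsionBy.nsmul_iff.mp hmem.2

end General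

section OverQ

variable (W : WeierstrassCurve ℚ) [W.IsElliptic] [W.IsGloballyMinimal]

/-- **X11 ∧ `p = 3` ∧ `r = 0` with `surj(3)` and `ord_3 #Ш_an ≤ 2`: `BSD(E,3)` from PUBLISHED
theorems plus the native rank-`0` certificate line `Sel^(3)(E/ℚ) ≠ 0`** (an EXACT or lower-bound
`3`-descent exhibiting one non-trivial Selmer class). The side conditions of
`exists_sha_torsion_of_selmerGroup_ne_bot` are derived: `rank = r_an = 0` (Gross–Zagier–Kolyvagin,
`hGZK`) and `3 ∤ #E(ℚ)_tors` (`irr(3)` from `ClassX11`, Mazur 1977); then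
`dvd_shaOrder_of_exists_torsion` and `X11ThreeRankZero.bsdp_of_casselsTate_of_three_dvd`
(Cassels–Tate `hCT`, Wuthrich Prop. 21 `hW`, modularity `hmod`). The 14 rank-`0` X11 ∧ `p = 3`
census-v5 pairs with `#Ш_an = 9` are instances (`dim Sel^(3) = 2`). Not a class theorem.
[cite: SilvermanAEC2009, Thm. X.4.14] -/
theorem X11ThreeRankZero.bsdp_of_casselsTate_of_selmerThree_ne_bot
    (hCT : exists_casselsTate_pairing (K := ℚ)) (hW : Wuthrich2014.sha_dvd_analyticSha)
    (hGZK : rank_eq_analyticRank_of_analyticRank_le_one) (hmod : hasEntireLFunction_rat)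
    (hr : W.analyticRank = 0) (hX : ClassX11 W 3) (hsurj : Surj W 3)
    {q : ℚ} (hq : shaAn W = (q : ℂ)) (hv : padicValRat 3 q ≤ 2)
    (hSel : W.selmerGroup (3 : ℤ) ≠ ⊥) : BSDp W 3 := by
  have hrank : W.mordellWeilRank = 0 := by
    rw [(hGZK W (by rw [hr]; norm_num)).1, hr]
  have htors : ¬ 3 ∣ W.torsionOrder := by
    intro h3
    have h0 := padicValNat_torsionOrder_eq_zero_of_irreducible W 3 hX.2.1
    rw [padicValNat.eq_zero_iff] at h0
    rcases h0 with h | h | h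
    · exact absurd h (by norm_num)
    · exact absurd h W.torsionOrder_pos_holds.ne'
    · exact h h3
  have hex : ∃ x : W.sha, x ≠ 0 ∧ 3 • x = 0 :=
    exists_sha_torsion_of_selmerGroup_ne_bot W 3 (by exact_mod_cast hSel) hrank htors
  exact X11ThreeRankZero.bsdp_of_casselsTate_of_three_dvd W hCT hW hGZK hmod hr hX hsurj hq hv
    (dvd_shaOrder_of_exists_torsion W 3 hex)

/-- **Class-free rank-`0` form: `BSD(E,p)` from PUBLISHED theorems plus the native certificate line
`Sel^(p)(E/ℚ) ≠ 0`** at a pair with `r_an = 0`, `p` odd, `E` not additive at `p`, surjective-or-Borel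
mod-`p` image, `ord_p #Ш_an ≤ 2` and `p ∤ #E(ℚ)_tors` (a per-curve datum: the torsion order).
Composition of `exists_sha_torsion_of_selmerGroup_ne_bot` (rank `0` from Gross–Zagier–Kolyvagin
`hGZK`), `dvd_shaOrder_of_exists_torsion` and `bsdp_of_wuthrich_of_casselsTate_of_dvd` (x11b gen 3:
Cassels–Tate `hCT`, Wuthrich Prop. 21 `hW`, modularity `hmod`). Serves the rank-`0` `#Ш_an = 9`
pairs of the classes X6/X7/X8 as well as X11 (cell census: `HOME/b2b-bsdres-x11b/desc3/`). Not a
class theorem. [cite: SilvermanAEC2009, Thm. X.4.14] -/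
theorem bsdp_of_wuthrich_of_casselsTate_of_selmerGroup_ne_bot (p : ℕ) [Fact p.Prime]
    (hCT : exists_casselsTate_pairing (K := ℚ)) (hW : Wuthrich2014.sha_dvd_analyticSha)
    (hGZK : rank_eq_analyticRank_of_analyticRank_le_one) (hmod : hasEntireLFunction_rat)
    (hp : p ≠ 2) (hr : W.analyticRank = 0)
    (hadd : ¬ ((W.baseChange ℚ_[p]).minimal ℤ_[p]).HasAdditiveReduction ℤ_[p])
    (himg : ¬ W.HasIrreducibleModPGaloisRep p ∨ W.HasSurjectiveModNGaloisRep p)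
    {q : ℚ} (hq : shaAn W = (q : ℂ)) (hv : padicValRat p q ≤ 2)
    (htors : ¬ p ∣ W.torsionOrder) (hSel : W.selmerGroup (p : ℤ) ≠ ⊥) : BSDp W p := by
  have hrank : W.mordellWeilRank = 0 := by
    rw [(hGZK W (by rw [hr]; norm_num)).1, hr]
  exact bsdp_of_wuthrich_of_casselsTate_of_dvd W p hCT hW hGZK hmod hp hr hadd himg hq hv
    (dvd_shaOrder_of_exists_torsion W p
      (exists_sha_torsion_of_selmerGroup_ne_bot W p hSel hrank htors))

end OverQ

section GeneralRank

variable {K : Type*} [Field K] [NumberField K] (W : WeierstrassCurve K) [W.IsElliptic]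

/-- **Native `p`-descent certificate at Mordell–Weil rank `r`: `#Sel^(p)(E/K) > p ^ r`,
`rank_ℤ E(K) = r`, `p ∤ #E(K)_tors` ⇒ `Ш(E/K)[p] ≠ 0`** (a non-zero element of `Ш(E/K)` killed by
`p`). The rank-`r` companion of `exists_sha_torsion_of_selmerGroup_ne_bot` (rank `0`), read off the
PROVED descent count `card_selmerGroup_eq_pow_rank_mul`
(`#Sel^(p)(E/K) = p ^ rank E(K) · #E(K)[p] · #Ш(E/K)[p]`, from the fundamental exact sequence
`selmer_exact_holds` and Mordell–Weil `module_finite_point_holds`): with no rational `p`-torsion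
`#E(K)[p] = 1`, so `#Sel^(p) > p ^ r` forces `#Ш(E/K)[p] > 1`. Typed for the Kurihara lane's
rank-one index rows (REQ-bsdN1-g29-1: an EXACT `3`-descent with `dim_𝔽₃ Sel^(3)(E/ℚ) ≥ 2` at
rank `1`, `3 ∤ #E(ℚ)_tors`, feeding `ClassX4M.bsdp_rankOne_of_indexValuation_of_exists_torsion_of_surj`).
[cite: SilvermanAEC2009, Thm X.4.2(a)] -/
theorem exists_sha_torsion_of_pow_rank_lt_card_selmerGroup (p : ℕ) [hp : Fact p.Prime] {r : ℕ}
    (hrank : W.mordellWeilRank = r) (htors : ¬ p ∣ W.torsionOrder)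
    (hSel : p ^ r < Nat.card (W.selmerGroup (p : ℤ))) :
    ∃ x : W.sha, x ≠ 0 ∧ p • x = 0 := by
  haveI : NeZero p := ⟨hp.out.ne_zero⟩
  haveI : Module.Finite ℤ W.toAffine.Point := W.module_finite_point_holds
  -- no rational `p`-torsion: `E(K)[p] = 0`
  have htorsBy : AddSubgroup.torsionBy W.toAffine.Point (p : ℤ) = ⊥ := by
    rw [eq_bot_iff]
    intro P hP
    rw [AddSubgroup.mem_bot]
    by_contra hP0
    have hpP : p • P = 0 := AddSubgroup.torsionBy.nsmul_iff.mp hP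
    have hord : addOrderOf P = p := addOrderOf_eq_prime hpP hP0
    have hfin : IsOfFinAddOrder P := by
      rw [← addOrderOf_pos_iff, hord]; exact hp.out.pos
    have hmemT : P ∈ AddCommGroup.torsion W.toAffine.Point := by
      rw [AddCommGroup.mem_torsion]; exact hfin
    have hordT : addOrderOf (⟨P, hmemT⟩ : AddCommGroup.torsion W.toAffine.Point) = p := by
      rw [← AddSubgroup.addOrderOf_coe]; exact hord
    apply htors
    have := addOrderOf_dvd_natCard (⟨P, hmemT⟩ : AddCommGroup.torsion W.toAffine.Point)
    rw [hordT] at this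
    exact this
  have hcardT : Nat.card (AddSubgroup.torsionBy W.toAffine.Point (p : ℤ)) = 1 := by
    rw [htorsBy]; exact AddSubgroup.card_bot
  -- the descent count: `#Sel^(p) = p ^ r · #Ш[p]`
  have hcount := card_selmerGroup_eq_pow_rank_mul W p
  rw [hrank, hcardT, mul_one] at hcount
  -- `#Ш[p] > 1`
  have hgt : 1 < Nat.card (W.sha ⊓ AddSubgroup.torsionBy W.galH1 (p : ℕ) : AddSubgroup W.galH1) := by
    by_contra hle
    rw [not_lt] at hle
    have hle' : Nat.card (W.selmerGroup (p : ℤ)) ≤ p ^ r := by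
      rw [hcount]
      calc p ^ r * Nat.card (W.sha ⊓ AddSubgroup.torsionBy W.galH1 (p : ℕ) : AddSubgroup W.galH1)
          ≤ p ^ r * 1 := Nat.mul_le_mul_left _ hle
        _ = p ^ r := mul_one _
    exact absurd hSel (not_lt.mpr hle')
  haveI : Finite (W.sha ⊓ AddSubgroup.torsionBy W.galH1 (p : ℕ) : AddSubgroup W.galH1) :=
    Nat.finite_of_card_ne_zero (by omega)
  haveI : Nontrivial (W.sha ⊓ AddSubgroup.torsionBy W.galH1 (p : ℕ) : AddSubgroup W.galH1) :=
    Finite.one_lt_card_iff_nontrivial.mp hgt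
  obtain ⟨y, hy⟩ := exists_ne (0 : (W.sha ⊓ AddSubgroup.torsionBy W.galH1 (p : ℕ) : AddSubgroup W.galH1))
  have hmem : (y : W.galH1) ∈ W.sha ⊓ AddSubgroup.torsionBy W.galH1 (p : ℤ) := y.2
  refine ⟨⟨(y : W.galH1), hmem.1⟩, ?_, ?_⟩
  · intro h
    have h' : (y : W.galH1) = 0 := congrArg Subtype.val h
    exact hy (Subtype.ext h')
  · apply Subtype.ext
    simpa only [AddSubgroupClass.coe_nsmul, ZeroMemClass.coe_zero] using
      AddSubgroup.torsionBy.nsmul_iff.mp hmem.2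

end GeneralRank

end Literature.NumberTheory.EllipticCurves.Rank1Residual.Typed

end
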